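import Literature.MathematicalPhysics.QuantumFieldTheory.TransferDecayUpgrade
import HarnessLib

/-!
# Stub `stub_haag_product_bound` of line `registered` (skeleton `Cruxes/TorusHalfSpectrum/Lines/birth.lean`)
(crux `Summit.QuantumFields.QCD.Theses.QuarksNoInfraredClause.TorusHalfSpectrum`, item stmt-QuantumFields-9508,
route route-QuantumFields-QuarksNoInfraredClause)

## Summary

The skeleton's `HaagProductBoundStmt` (stub E4), unfolded: the OPERATOR half of Haag's half-spectrum lemma
(Haag, Local Quantum Physics, Thm. II.5.4.1) in the tree's `TransferData` vocabulary.  For a positive contraction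
`T` with unit vacuum `Ω` (`T Ω = Ω`), a sequence of "neutral" vectors `w_j`, each clustering EVENTUALLY at rate
`r²` with its OWN constant and threshold (`‖⟪w_j, Tⁿ w_j⟫ − ⟪w_j, Ω⟫⟪Ω, w_j⟫‖ ≤ K_j (r²)ⁿ` for large `n`),
uniformly bounded `‖w_j‖ ≤ M`, without long-range order `⟪Ω, w_j⟫ → 0`, and splitting
`⟪w_j, Tⁿ w_j⟫ → ⟪v, Tⁿ v⟫ · ⟪v', Tⁿ v'⟫` for every `n`, forces
`re ⟪v, Tⁿ v⟫ · re ⟪v', Tⁿ v'⟫ ≤ M² (r²)ⁿ` for EVERY `n`.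

Proof.  (1) For each `j` the decay upgrade at rate `r²`
(`TransferData.re_inner_pow_sub_le_truncNorm_mul_pow_of_eventually`, which washes out the constant `K_j` and the
threshold) gives `re ⟪w_j, Tⁿ w_j⟫ − ‖⟪Ω, w_j⟫‖² ≤ (‖w_j‖² − ‖⟪Ω, w_j⟫‖²) (r²)ⁿ`, hence
`re ⟪w_j, Tⁿ w_j⟫ ≤ M² (r²)ⁿ + ‖⟪Ω, w_j⟫‖²`.  (2) Let `j → ∞`: the left side tends to
`re (⟪v, Tⁿ v⟫ ⟪v', Tⁿ v'⟫)` (splitting, continuity of `re`), the right side to `M² (r²)ⁿ` (no long-range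
order), so `re (⟪v, Tⁿ v⟫ ⟪v', Tⁿ v'⟫) ≤ M² (r²)ⁿ` (`le_of_tendsto_of_tendsto'`).  (3) `Tⁿ` is symmetric
(`TransferData.inner_pow_apply_left`), so `⟪v, Tⁿ v⟫` and `⟪v', Tⁿ v'⟫` are real and the real part of the
product is the product of the real parts (`RCLike.mul_re`).
-/

namespace Summit.QuantumFields.QCD.Cruxes.TorusHalfSpectrum.Birth.HaagProductBound

open Filter Topology
open scoped InnerProductSpace ComplexConjugate
open Literature.Probability.LatticeModels

/-- Diagonal matrix elements of the powers of the (symmetric) transfer operator are real: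
`im ⟪x, Tⁿ x⟫ = 0`, since `conj ⟪x, Tⁿ x⟫ = ⟪Tⁿ x, x⟫ = ⟪x, Tⁿ x⟫` (`TransferData.inner_pow_apply_left`). -/
theorem im_inner_pow_apply_self_eq_zero {H : Type*} [NormedAddCommGroup H] [InnerProductSpace ℂ H]
    (D : TransferData H) (x : H) (n : ℕ) : RCLike.im ⟪x, (D.T ^ n) x⟫_ℂ = 0 := by
  rw [← RCLike.conj_eq_iff_im, inner_conj_symm, D.inner_pow_apply_left]

/-- The real part of the product of two diagonal matrix elements of `Tⁿ` is the product of their real parts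
(both factors are real, `im_inner_pow_apply_self_eq_zero`). -/
theorem re_inner_pow_mul_inner_pow {H : Type*} [NormedAddCommGroup H] [InnerProductSpace ℂ H]
    (D : TransferData H) (x y : H) (n : ℕ) :
    RCLike.re (⟪x, (D.T ^ n) x⟫_ℂ * ⟪y, (D.T ^ n) y⟫_ℂ) =
      RCLike.re ⟪x, (D.T ^ n) x⟫_ℂ * RCLike.re ⟪y, (D.T ^ n) y⟫_ℂ := by
  rw [RCLike.mul_re, im_inner_pow_apply_self_eq_zero D x n, zero_mul, sub_zero]

/-- The per-vector step of Haag's product bound: if the diagonal pair `(x, x)` clusters EVENTUALLY at rate `s`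
(`0 < s`) with SOME constant, and `‖x‖ ≤ M`, then for EVERY `n`
`re ⟪x, Tⁿ x⟫ ≤ M² sⁿ + ‖⟪Ω, x⟫‖²` — the decay upgrade
`TransferData.re_inner_pow_sub_le_truncNorm_mul_pow_of_eventually` followed by `‖x‖² − ‖⟪Ω, x⟫‖² ≤ M²`. -/
theorem re_inner_pow_le_of_eventually {H : Type*} [NormedAddCommGroup H] [InnerProductSpace ℂ H]
    [CompleteSpace H] (D : TransferData H) (x : H) {s K M : ℝ} (hs : 0 < s)
    (h : ∀ᶠ n in atTop, ‖⟪x, (D.T ^ n) x⟫_ℂ - ⟪x, D.vacuum⟫_ℂ * ⟪D.vacuum, x⟫_ℂ‖ ≤ K * s ^ n)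
    (hM : ‖x‖ ≤ M) (n : ℕ) :
    RCLike.re ⟪x, (D.T ^ n) x⟫_ℂ ≤ M ^ 2 * s ^ n + ‖⟪D.vacuum, x⟫_ℂ‖ ^ 2 := by
  have h1 := D.re_inner_pow_sub_le_truncNorm_mul_pow_of_eventually x hs h n
  have hp : 0 ≤ s ^ n := pow_nonneg hs.le n
  have hW : ‖x‖ ^ 2 ≤ M ^ 2 := pow_le_pow_left₀ (norm_nonneg _) hM 2
  have hWp : ‖x‖ ^ 2 * s ^ n ≤ M ^ 2 * s ^ n := mul_le_mul_of_nonneg_right hW hp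
  have hbp : 0 ≤ ‖⟪D.vacuum, x⟫_ℂ‖ ^ 2 * s ^ n := mul_nonneg (sq_nonneg _) hp
  have hexp : (‖x‖ ^ 2 - ‖⟪D.vacuum, x⟫_ℂ‖ ^ 2) * s ^ n =
      ‖x‖ ^ 2 * s ^ n - ‖⟪D.vacuum, x⟫_ℂ‖ ^ 2 * s ^ n := by ring
  rw [hexp] at h1
  linarith

/-- **Haag's product bound, transfer-operator form** (= the skeleton's `HaagProductBoundStmt`, stub E4; the
operator half of Haag's half-spectrum lemma, Local Quantum Physics Thm. II.5.4.1).  For a positive contraction `T`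
with unit vacuum `Ω`, neutral vectors `w_j` clustering eventually at rate `r²` with per-vector constants and
thresholds, `‖w_j‖ ≤ M`, no long-range order `⟪Ω, w_j⟫ → 0` and splitting `⟪w_j, Tⁿ w_j⟫ → ⟪v, Tⁿ v⟫⟪v', Tⁿ v'⟫`
force `re ⟪v, Tⁿ v⟫ · re ⟪v', Tⁿ v'⟫ ≤ M² (r²)ⁿ` for EVERY `n`: the decay upgrade
(`re_inner_pow_le_of_eventually`) bounds `re ⟪w_j, Tⁿ w_j⟫ ≤ M² (r²)ⁿ + ‖⟪Ω, w_j⟫‖²` for every `j` and `n`, the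
limit `j → ∞` (`le_of_tendsto_of_tendsto'`) gives `re (⟪v, Tⁿ v⟫⟪v', Tⁿ v'⟫) ≤ M² (r²)ⁿ`, and both factors are
real (`re_inner_pow_mul_inner_pow`). -/
theorem stub_haag_product_bound :
    ∀ (H : Type) [NormedAddCommGroup H] [InnerProductSpace ℂ H] [CompleteSpace H]
      (D : _root_.Literature.Probability.LatticeModels.TransferData H) (v v' : H) (w : ℕ → H) (r M : ℝ),
      0 < r →
      (∀ j : ℕ, ∃ K : ℝ, ∀ᶠ n : ℕ in atTop,
          ‖inner ℂ (w j) ((D.T ^ n) (w j)) - inner ℂ (w j) D.vacuum * inner ℂ D.vacuum (w j)‖ ≤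
            K * (r ^ 2) ^ n) →
      (∀ j : ℕ, ‖w j‖ ≤ M) →
      Tendsto (fun j : ℕ => inner ℂ D.vacuum (w j)) atTop (nhds 0) →
      (∀ n : ℕ, Tendsto (fun j : ℕ => inner ℂ (w j) ((D.T ^ n) (w j)) -
          inner ℂ v ((D.T ^ n) v) * inner ℂ v' ((D.T ^ n) v')) atTop (nhds 0)) →
      ∀ n : ℕ, RCLike.re (inner ℂ v ((D.T ^ n) v)) * RCLike.re (inner ℂ v' ((D.T ^ n) v')) ≤
        M ^ 2 * (r ^ 2) ^ n := by
  intro H _ _ _ D v v' w r M hr h₁ h₂ h₃ h₄ n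
  have hr2 : 0 < r ^ 2 := pow_pos hr 2
  -- (1) the per-`j` bound, uniform in `j` up to the long-range-order term
  have hstep : ∀ j : ℕ,
      RCLike.re ⟪w j, (D.T ^ n) (w j)⟫_ℂ ≤ M ^ 2 * (r ^ 2) ^ n + ‖⟪D.vacuum, w j⟫_ℂ‖ ^ 2 := by
    intro j
    obtain ⟨K, hK⟩ := h₁ j
    exact re_inner_pow_le_of_eventually D (w j) hr2 hK (h₂ j) n
  -- (2) the limit `j → ∞`
  have hlim : Tendsto (fun j : ℕ => ⟪w j, (D.T ^ n) (w j)⟫_ℂ) atTop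
      (𝓝 (⟪v, (D.T ^ n) v⟫_ℂ * ⟪v', (D.T ^ n) v'⟫_ℂ)) :=
    tendsto_sub_nhds_zero_iff.1 (h₄ n)
  have hre : Tendsto (fun j : ℕ => RCLike.re ⟪w j, (D.T ^ n) (w j)⟫_ℂ) atTop
      (𝓝 (RCLike.re (⟪v, (D.T ^ n) v⟫_ℂ * ⟪v', (D.T ^ n) v'⟫_ℂ))) :=
    (RCLike.continuous_re.tendsto _).comp hlim
  have hb0 : Tendsto (fun j : ℕ => ‖⟪D.vacuum, w j⟫_ℂ‖ ^ 2) atTop (𝓝 0) := by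
    have h := (tendsto_zero_iff_norm_tendsto_zero.1 h₃).pow 2
    rwa [zero_pow two_ne_zero] at h
  have hrhs : Tendsto (fun j : ℕ => M ^ 2 * (r ^ 2) ^ n + ‖⟪D.vacuum, w j⟫_ℂ‖ ^ 2) atTop
      (𝓝 (M ^ 2 * (r ^ 2) ^ n)) := by
    have h := hb0.const_add (M ^ 2 * (r ^ 2) ^ n)
    rwa [add_zero] at h
  have hle : RCLike.re (⟪v, (D.T ^ n) v⟫_ℂ * ⟪v', (D.T ^ n) v'⟫_ℂ) ≤ M ^ 2 * (r ^ 2) ^ n :=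
    le_of_tendsto_of_tendsto' hre hrhs hstep
  -- (3) both factors are real
  rwa [re_inner_pow_mul_inner_pow D v v' n] at hle

end Summit.QuantumFields.QCD.Cruxes.TorusHalfSpectrum.Birth.HaagProductBound
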